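import Mathlib
import Summits.Ventures.HodgeRepro.Tier4.Common.AdelicDefs
import Summits.Ventures.HodgeRepro.Tier4.Line1.RationalPoints
import Summits.Ventures.HodgeRepro.Tier4.Line1.AdicIntegersCompact

/-!
# Tier4/Line1/LocallyCompactGA — (I1-g) of LINE L1: `U(W)(𝔸_k)` is locally compact

Blind re-derivation cell `pub-hodge-repro`, Tier 4 (README §9–§10), seat t4-L1-p5 (prover, LINE L1, gen 0).
Registered statement: `Skeleton.lean` v0.10 (3d8356354c198ec9…, 1095 l.) L657 `locallyCompact_GA`, proved here
EXACTLY as typed.  Chain: `𝓞_v` compact (`Tier4/Line1/AdicIntegersCompact.lean`) ⇒ the finite adele ring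
`Πʳ_v [k_v, 𝓞_v]` is a locally compact additive group (Mathlib's restricted-product instance) ⇒ `𝔸_k = 𝔸_{k,∞} × 𝔸_{k,f}`
locally compact (`NumberField.InfiniteAdeleRing.locallyCompactSpace`) ⇒ `M₄(𝔸_k)` locally compact ⇒ `GL₄(𝔸_k)`, a
closed subspace of `M₄(𝔸_k) × M₄(𝔸_k)ᵐᵒᵖ` under `g ↦ (g, g⁻¹)` (`Units.isClosedEmbedding_embedProduct`), locally
compact ⇒ `U(W)(𝔸_k)`, the closed subset `{g | gΩ = Ωg ∧ gBgᵀ = B}` of `GL₄(𝔸_k)`, locally compact.  Also recorded: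
`LocallyCompactSpace (FiniteAdeleRing (𝓞 k) k)`, `LocallyCompactSpace (AdeleRing (𝓞 k) k)`, `LocallyCompactSpace (GL4 k)`,
and the closedness of `unitaryGroup W` in `GL₄(𝔸_k)`.

Nothing here says anything about the status of the Hodge conjecture for CM abelian varieties, which is NOT proved
(HC_CM is NOT proved by anyone in this repository).
-/

set_option autoImplicit false

noncomputable section

namespace Summit.Ventures.HodgeRepro.Tier4.Line1

open NumberField IsDedekindDomain HeightOneSpectrum Common Topology

section Adeles

variable (k : Type) [Field k] [NumberField k]

open scoped RestrictedProduct in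
/-- **The finite adele ring is locally compact** (restricted product of the locally compact `k_v` with respect to
the compact open subrings `𝓞_v`). -/
theorem locallyCompactSpace_finiteAdeleRing : LocallyCompactSpace (FiniteAdeleRing (𝓞 k) k) := by
  haveI : Fact (∀ v : HeightOneSpectrum (𝓞 k),
      IsOpen (v.adicCompletionIntegers k : Set (v.adicCompletion k))) :=
    ⟨fun v => Valued.isOpen_valuationSubring _⟩
  haveI : ∀ v : HeightOneSpectrum (𝓞 k), CompactSpace (v.adicCompletionIntegers k) :=
    fun v => compactSpace_adicCompletionIntegers k v
  exact inferInstanceAs (LocallyCompactSpace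
    (Πʳ v : HeightOneSpectrum (𝓞 k), [v.adicCompletion k, v.adicCompletionIntegers k]))

/-- **The adele ring is locally compact.** -/
theorem locallyCompactSpace_adeleRing : LocallyCompactSpace (AdeleRing (𝓞 k) k) :=
  haveI := locallyCompactSpace_finiteAdeleRing k
  inferInstanceAs (LocallyCompactSpace (InfiniteAdeleRing k × FiniteAdeleRing (𝓞 k) k))

/-- `GL₄(𝔸_k)` is locally compact: a closed subspace of `M₄(𝔸_k) × M₄(𝔸_k)ᵐᵒᵖ`. -/
theorem locallyCompactSpace_GL4 : LocallyCompactSpace (GL4 k) := by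
  haveI := locallyCompactSpace_adeleRing k
  haveI := t2Space_adeleRing k
  haveI : LocallyCompactSpace (M4 k) := inferInstanceAs (LocallyCompactSpace (Fin 4 → Fin 4 → Ad k))
  exact (Units.isClosedEmbedding_embedProduct (α := M4 k)).locallyCompactSpace

end Adeles

section Instance

variable {k : Type} [Field k] [NumberField k] (W : PlaneData k)

/-- `U(W)(𝔸_k)` is closed in `GL₄(𝔸_k)`: the zero set of two continuous matrix equations in a Hausdorff ring. -/
theorem isClosed_unitaryGroup : IsClosed ((unitaryGroup W : Subgroup (GL4 k)) : Set (GL4 k)) := by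
  haveI := t2Space_adeleRing k
  have h1 : IsClosed {g : GL4 k | (↑g : M4 k) * adMat k W.Ω = adMat k W.Ω * (↑g : M4 k)} :=
    isClosed_eq (Units.continuous_val.mul continuous_const) (continuous_const.mul Units.continuous_val)
  have h2 : IsClosed {g : GL4 k | (↑g : M4 k) * adMat k W.B * (↑g : M4 k).transpose = adMat k W.B} :=
    isClosed_eq ((Units.continuous_val.mul continuous_const).mul Units.continuous_val.matrix_transpose)
      continuous_const
  exact h1.inter h2

/-- (I1-g, LINE L1, Skeleton.lean L657): **`U(W)(𝔸_k)` is locally compact** — a closed subset of the locally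
compact `GL₄(𝔸_k)`. -/
theorem locallyCompact_GA : LocallyCompactSpace (GA W) := by
  haveI := locallyCompactSpace_GL4 k
  exact (isClosed_unitaryGroup W).locallyCompactSpace

end Instance

end Summit.Ventures.HodgeRepro.Tier4.Line1

end
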